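import Summits.ValiantsHypothesis.ValiantsHypothesis.Theorems.DivisionGapPerDivisionHardStubPricedCut
import Summits.ValiantsHypothesis.ValiantsHypothesis.Theorems.DivisionGapPerDivisionHardStubKeyRigid

/-!
# Crux `DivisionGap.PerDivisionHard` (stmt-ValiantsHypothesis-5065), line `pair-descent-jss-endpoint` —
stub `stub_exposedRigid` (skeleton v15.3, the lead's stub): K2 for cofactors with an EXPOSED point on a small cell set

If all monomials of `h ≠ 0` have one degree and, for some cell set `K` with `4|K| ≤ n` and some prices
`p : cells → ℕ`, the functional `m ↦ Σ_{e∈K} p(e)·m(e)` has a UNIQUE minimiser `ms` on `supp h`, then the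
placement of the block arsenal `G(b,1) ⊕ M₀` with its face OFF `K` (`stub_keyPlacement`,
`b = (log₂ n + d)^d`) and the PRICED cut with prices `u(e) = 1 + (D+1)·p(e)·[e ∈ K]` off the face
(`stub_pricedCut` without lures; `D = deg h`) have the one-monomial top fibre `{ms}`: the fibre is the
set of minimisers of `Φ(m) = Σ_{e∉G} u(e)·m(e) = Σ_{e∉G} m(e) + (D+1)·Σ_{e∈K} p(e)·m(e)`, and a
non-minimiser of `p` loses at least `D+1` on the second term while gaining at most `D` on the first.
This is the small-support form of "a vertex of the dominant of the off-face projection of `supp h`"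
(dossier v8 §4); it contains lexicographic isolation (`stub_isolationRigid`) and keys (`stub_keyRigid`).
-/

noncomputable section

-- `Summit.ValiantsHypothesis.ValiantsHypothesis.…` is the tree's mandated single-conjunct layout
-- (Sub = Summit), so the duplicated namespace component is intended.
set_option linter.dupNamespace false

namespace Summit.ValiantsHypothesis.ValiantsHypothesis.Theorems.DivisionGapPerDivisionHard

open MvPolynomial Literature.Computability.AlgebraicComplexity
open Summit.ValiantsHypothesis.ValiantsHypothesis.Theorems.ZeroOneTransfer.Negative
  (topComponent support_topComponent_subset topComponent_ne_zero)
open scoped NNReal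

/-- The exponents of a monomial of `h` sum to at most `deg h` over any set of cells. [folklore] -/
theorem sum_le_totalDegree_of_mem_support {n : ℕ} {h : MvPolynomial (Fin n × Fin n) ℝ≥0}
    {mo : (Fin n × Fin n) →₀ ℕ} (hmo : mo ∈ h.support) (F : Finset (Fin n × Fin n)) :
    ∑ e ∈ F, mo e ≤ h.totalDegree := by
  calc ∑ e ∈ F, mo e ≤ ∑ e, mo e :=
        Finset.sum_le_sum_of_subset_of_nonneg (Finset.subset_univ F) fun _ _ _ => Nat.zero_le _
    _ = mo.degree := by
        rw [Finsupp.degree_eq_weight_one, Finsupp.weight_apply, Finsupp.sum_fintype _ _ (by simp)]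
        simp
    _ ≤ h.totalDegree := by
        rw [Finsupp.degree_eq_weight_one, ← weightedTotalDegree_one]
        exact le_weightedTotalDegree _ hmo

/-- **`stub_exposedRigid` (K2 of line `pair-descent-jss-endpoint` for cofactors with an EXPOSED point;
skeleton v15.3, the lead's stub).**  For every `d` there is `n₀` such that for `n ≥ n₀`: if all
monomials of `h ≠ 0` have one degree, `4|K| ≤ n`, and `ms ∈ supp h` is the unique minimiser on `supp h`
of `m ↦ Σ_{e∈K} p(e)·m(e)`, then some placement `eR eC` of `G(b,1) ⊕ M₀` with `b = (log₂ n + d)^d`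
(face off `K`), some weight `w` cutting out its face and some `u` give
`HasSingleGPart (placedBlock eR eC) w h u`. [folklore] -/
theorem stub_exposedRigid :
    ∀ d : ℕ, ∃ n₀ : ℕ, ∀ n ≥ n₀, ∀ h : MvPolynomial (Fin n × Fin n) ℝ≥0, h ≠ 0 →
      (∀ m₁ ∈ h.support, ∀ m₂ ∈ h.support, m₁.degree = m₂.degree) →
      ∀ (K : Finset (Fin n × Fin n)) (p : Fin n × Fin n → ℕ), 4 * K.card ≤ n →
      ∀ ms ∈ h.support,
      (∀ m' ∈ h.support, m' ≠ ms → ∑ e ∈ K, p e * ms e < ∑ e ∈ K, p e * m' e) →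
      ∃ (b k m : ℕ) (eR eC : BlockV b k m ≃ Fin n) (w : Fin n × Fin n → ℕ)
        (u : (Fin n × Fin n) →₀ ℕ),
        (Nat.log 2 n + d) ^ d ≤ b ∧ CutsOut w (placedBlock eR eC) ∧
          HasSingleGPart (placedBlock eR eC) w h u := by
  intro d
  obtain ⟨n₀, hfit⟩ := stub_blockFits d
  refine ⟨n₀ + 64, fun n hn h hh hdeg K p hK ms hms hexp => ?_⟩
  classical
  set b := (Nat.log 2 n + d) ^ d with hb
  -- room for the placement off `K`
  have h8 : b + b * (b * 8) ≤ n := hfit n (by omega) 8 (by omega)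
  have hN : 4 * (b + b * (b * 1)) ≤ n := le_trans (four_mul_block_le b) h8
  have hroom : 2 * K.card + 2 * (b + b * (b * 1)) ≤ n := by omega
  obtain ⟨eR, eC, havoid⟩ := stub_keyPlacement b n K hroom
  set G := placedBlock eR eC with hG
  -- the priced cut, no lures, prices `1 + (D+1)·p·𝟙_K`
  set D := h.totalDegree with hD
  set pr : Fin n × Fin n → ℕ := fun e => 1 + (D + 1) * (if e ∈ K then p e else 0) with hpr
  obtain ⟨w, hcut, hchar⟩ := stub_pricedCut b 1 (n - (b + b * (b * 1))) n eR eC ∅ ∅ pr h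
    (Finset.disjoint_empty_left _) (fun e _ _ => by simp [hpr]) hdeg
  -- the off set is `Gᶜ`
  set F : Finset (Fin n × Fin n) := (Finset.univ : Finset (Fin n × Fin n)).filter (fun e => e ∉ G ∧
      ¬ ∃ p' ∈ (∅ : Finset (Fin (n - (b + b * (b * 1))))), ∃ q ∈ (∅ : Finset (Fin (n - (b + b * (b * 1))))),
        e = (eR (Sum.inr (Sum.inr p')), eC (Sum.inr (Sum.inr q)))) with hF
  have hKF : K ⊆ F := by
    intro e he
    simp only [hF, Finset.mem_filter, Finset.mem_univ, true_and, Finset.notMem_empty, false_and,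
      exists_false, not_false_eq_true, and_true]
    exact fun heG => havoid e heG he
  -- the price functional splits as `Σ_F m + (D+1)·Σ_K p·m`
  have hΦ : ∀ mo : (Fin n × Fin n) →₀ ℕ,
      ∑ e ∈ F, pr e * mo e = ∑ e ∈ F, mo e + (D + 1) * ∑ e ∈ K, p e * mo e := by
    intro mo
    have hsplit : ∀ e, pr e * mo e = mo e + (D + 1) * ((if e ∈ K then p e else 0) * mo e) := by
      intro e; simp only [hpr]; ring
    rw [Finset.sum_congr rfl fun e _ => hsplit e, Finset.sum_add_distrib, ← Finset.mul_sum]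
    congr 2
    rw [show (∑ e ∈ F, (if e ∈ K then p e else 0) * mo e) = ∑ e ∈ F, (if e ∈ K then p e * mo e else 0)
        from Finset.sum_congr rfl fun e _ => by split_ifs <;> simp,
      Finset.sum_ite_mem, Finset.inter_eq_right.mpr hKF]
  -- its top fibre is `{ms}`
  have hfib : ∀ mo ∈ (topComponent w h).support, mo = ms := by
    intro mo hmo
    obtain ⟨hmoh, hmin⟩ := (hchar mo).mp hmo
    by_contra hne
    have hlt := hexp mo hmoh hne
    have hle := hmin ms hms
    rw [hΦ mo, hΦ ms] at hle
    have hD' : ∑ e ∈ F, ms e ≤ D := sum_le_totalDegree_of_mem_support hms F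
    have hstep : (D + 1) * (∑ e ∈ K, p e * ms e + 1) ≤ (D + 1) * ∑ e ∈ K, p e * mo e :=
      Nat.mul_le_mul_left _ hlt
    nlinarith [Finset.sum_nonneg (fun e (_ : e ∈ F) => Nat.zero_le (mo e))]
  -- conclusion
  refine ⟨b, 1, n - (b + b * (b * 1)), eR, eC, w, ms.filter (· ∈ G), le_rfl, hcut,
    fun f hf => ?_, fun m' hm' f hf => ?_⟩
  · rw [Finsupp.support_filter] at hf
    exact (Finset.mem_filter.mp hf).2
  · rw [hfib m' hm', Finsupp.filter_apply_pos _ _ hf]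

end Summit.ValiantsHypothesis.ValiantsHypothesis.Theorems.DivisionGapPerDivisionHard

end
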